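import Mathlib.FieldTheory.Normal.Closure
import Mathlib.LinearAlgebra.FreeModule.Finite.Matrix
import Mathlib.CategoryTheory.Equivalence
import Mathlib.CategoryTheory.HomCongr
import Literature.AlgebraicGeometry.Frobenioids.FinSubextCat
import HarnessLib

/-!
# Frobenioids I, Example 6.3 / Theorem 6.4 (ii): the degree `[L : F]` of an object `Spec L` of the base category
# `D = {finite subextensions of K/F}` is CATEGORY-THEORETIC, hence invariant under any equivalence `D₁ ⥲ D₂`

Mochizuki, *The geometry of Frobenioids I: the general theory*, Kyushu J. Math. **62** (2008) 293–400,
Example 6.3 p. 113 (the base category `D` of the arithmetic Frobenioid `C_{K̃/F}`: "schemes `Spec(L)`, where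
`L ⊆ K̃` is a finite extension of `F`", morphisms over `Spec F`) and Theorem 6.4 (ii) p. 114 ("there exists an
element `deg(Ψ^rlf) ∈ ℝ_{>0}`" — ONE constant for all Frobenius-trivial objects; in the proof, p. 115 l. 34 –
p. 116 l. 3, the objects over different `Spec L` are compared along morphisms `Spec L_B → Spec L_A`, whose effect
on degrees of arithmetic divisors is multiplication by `[L_B : L_A]`) [cite: MochizukiFrdI2008, Thm. 6.4 (ii) p.114].

PROOF-ONLY file (no definitions; seat abc-iut-L1-t12, cell row «E3» of the T64ii/L04 decomposition of
abc-iut-w4-d086, 2026-08-26): the Mathlib-level input «any equivalence `Ψ^Base : D₁ ⥲ D₂` of base categories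
`D_i = FinSubextCat F_i K_i` preserves the degrees `[L : F_i]` of objects, hence the relative degrees
`[L_B : L_A]` of morphisms», via the categorical description of the degree:

* `natCard_hom_le_finrank` — `#Hom(Z, X) = #Hom_F(L_X, L_Z) ≤ [L_X : F]` for all `Z` (linear independence of
  embeddings, Mathlib `card_algHom_le_finrank`);
* `exists_natCard_hom_eq_finrank` — if `K/F` is normal and separable (e.g. `K = F̃`, or `K/F` Galois), the normal
  closure `Z` of `L_X` inside `K` has `#Hom(Z, X) = [L_X : F]` (Mathlib `AlgHom.card_of_splits`); so
  `[L_X : F] = max_Z #Hom(Z, X)`;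
* `finrank_obj_eq_of_equivalence` — an equivalence preserves Hom-cardinalities and is essentially surjective, so
  it preserves `[L : F]`; `finrank_along_map_eq_of_equivalence` — hence it preserves the relative degree
  `[L_X : L_Y]` of a morphism `X → Y` (tower law).

Nothing here is specific to the abc programme.
-/

namespace Literature.AlgebraicGeometry.Frobenioids

namespace FinSubextCat

open CategoryTheory Module

universe u

section OneBase

variable {F : Type u} [Field F] {K : Type u} [Field K] [Algebra F K]

/-- `Hom(Z, X)` in `D` is in bijection with the `F`-embeddings `L_X → L_Z`, so the two have the same
cardinality. [cite: MochizukiFrdI2008, Ex. 6.3 p.113] -/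
theorem natCard_hom_eq (Z X : FinSubextCat F K) : Nat.card (Z ⟶ X) = Nat.card (X.L →ₐ[F] Z.L) :=
  Nat.card_congr ⟨fun f => f.toAlgHom, fun g => ⟨g⟩, fun _ => rfl, fun _ => rfl⟩

/-- **`#Hom(Z, X) ≤ [L_X : F]`** for every object `Z` (distinct `F`-embeddings `L_X → L_Z` are linearly
independent). [cite: MochizukiFrdI2008, Ex. 6.3 p.113] -/
theorem natCard_hom_le_finrank (Z X : FinSubextCat F K) : Nat.card (Z ⟶ X) ≤ finrank F X.L := by
  rw [natCard_hom_eq]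
  exact card_algHom_le_finrank F X.L Z.L

/-- The set `Hom(Z, X)` is finite. [cite: MochizukiFrdI2008, Ex. 6.3 p.113] -/
theorem finite_hom (Z X : FinSubextCat F K) : Finite (Z ⟶ X) :=
  Finite.of_equiv _ (⟨fun f => f.toAlgHom, fun g => ⟨g⟩, fun _ => rfl, fun _ => rfl⟩ :
    (Z ⟶ X) ≃ (X.L →ₐ[F] Z.L)).symm

/-- **`[L_X : F]` is attained**: if `K/F` is normal and separable, the normal closure `Z = Spec N` of `L_X`
inside `K` (a finite subextension) satisfies `#Hom(Z, X) = [L_X : F]` — every `F`-embedding of `L_X` into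
`K` lands in `N`, and there are `[L_X : F]` of them. [cite: MochizukiFrdI2008, Ex. 6.3 p.113] -/
theorem exists_natCard_hom_eq_finrank [Normal F K] [Algebra.IsSeparable F K] (X : FinSubextCat F K) :
    ∃ Z : FinSubextCat F K, Nat.card (Z ⟶ X) = finrank F X.L := by
  haveI := normalClosure.is_finiteDimensional F X.L K
  refine ⟨@FinSubextCat.mk F _ K _ _ (IntermediateField.normalClosure F X.L K) inferInstance, ?_⟩
  rw [natCard_hom_eq]
  show Nat.card (X.L →ₐ[F] IntermediateField.normalClosure F X.L K) = finrank F X.L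
  haveI : Algebra.IsSeparable F X.L := Algebra.isSeparable_tower_bot_of_isSeparable F X.L K
  rw [Nat.card_eq_fintype_card]
  refine AlgHom.card_of_splits F X.L (IntermediateField.normalClosure F X.L K) fun x => ?_
  -- `L_X ⊆ N`, and `N/F` is normal, so the minimal polynomial of `x ∈ L_X` splits in `N`
  have hle : X.L ≤ IntermediateField.normalClosure F X.L K := by
    simpa only [IntermediateField.fieldRange_val] using AlgHom.fieldRange_le_normalClosure X.L.val
  have hx : minpoly F (IntermediateField.inclusion hle x) = minpoly F x :=
    minpoly.algHom_eq _ (IntermediateField.inclusion hle).injective x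
  rw [← hx]
  exact Normal.splits (normalClosure.normal F X.L K) _

/-- Hence, for `K/F` normal and separable, **`[L_X : F]` is the maximum of `#Hom(Z, X)` over all objects `Z`**
— a purely category-theoretic description of the degree. [cite: MochizukiFrdI2008, Ex. 6.3 p.113] -/
theorem finrank_eq_iSup_natCard_hom [Normal F K] [Algebra.IsSeparable F K] (X : FinSubextCat F K) :
    finrank F X.L = ⨆ Z : FinSubextCat F K, Nat.card (Z ⟶ X) := by
  haveI : Nonempty (FinSubextCat F K) := ⟨X⟩
  apply le_antisymm
  · obtain ⟨Z, hZ⟩ := exists_natCard_hom_eq_finrank X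
    rw [← hZ]
    exact le_ciSup (f := fun Z : FinSubextCat F K => Nat.card (Z ⟶ X))
      ⟨finrank F X.L, by rintro _ ⟨Z', rfl⟩; exact natCard_hom_le_finrank Z' X⟩ Z
  · exact ciSup_le fun Z => natCard_hom_le_finrank Z X

end OneBase

section TwoBases

variable {F₁ : Type u} [Field F₁] {K₁ : Type u} [Field K₁] [Algebra F₁ K₁]
  {F₂ : Type u} [Field F₂] {K₂ : Type u} [Field K₂] [Algebra F₂ K₂]

/-- A fully faithful functor preserves the cardinalities `#Hom(Z, X)`. [cite: MochizukiFrdI2008, Thm. 6.4 (ii) p.114] -/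
theorem natCard_hom_map_eq (Ψ : FinSubextCat F₁ K₁ ⥤ FinSubextCat F₂ K₂) [Ψ.Full] [Ψ.Faithful]
    (Z X : FinSubextCat F₁ K₁) : Nat.card (Ψ.obj Z ⟶ Ψ.obj X) = Nat.card (Z ⟶ X) :=
  (Nat.card_congr (Functor.FullyFaithful.ofFullyFaithful Ψ).homEquiv).symm

/-- A fully faithful functor does not DECREASE degrees: `[L_X : F₁] ≤ [L_{Ψ X} : F₂]` (for `K₁/F₁` normal and
separable). [cite: MochizukiFrdI2008, Thm. 6.4 (ii) p.114] -/
theorem finrank_le_finrank_obj_of_fullyFaithful [Normal F₁ K₁] [Algebra.IsSeparable F₁ K₁]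
    (Ψ : FinSubextCat F₁ K₁ ⥤ FinSubextCat F₂ K₂) [Ψ.Full] [Ψ.Faithful] (X : FinSubextCat F₁ K₁) :
    finrank F₁ X.L ≤ finrank F₂ (Ψ.obj X).L := by
  obtain ⟨Z, hZ⟩ := exists_natCard_hom_eq_finrank X
  rw [← hZ, ← natCard_hom_map_eq Ψ Z X]
  exact natCard_hom_le_finrank _ _

/-- **The degree of an object is invariant under equivalences of base categories**: for `K_i/F_i` normal and
separable and ANY equivalence `Ψ : D₁ ⥲ D₂`, `[L_{Ψ X} : F₂] = [L_X : F₁]`. [cite: MochizukiFrdI2008, Thm. 6.4 (ii) p.114] -/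
theorem finrank_obj_eq_of_equivalence [Normal F₁ K₁] [Algebra.IsSeparable F₁ K₁] [Normal F₂ K₂]
    [Algebra.IsSeparable F₂ K₂] (e : FinSubextCat F₁ K₁ ≌ FinSubextCat F₂ K₂) (X : FinSubextCat F₁ K₁) :
    finrank F₂ (e.functor.obj X).L = finrank F₁ X.L := by
  apply le_antisymm
  · -- a maximising `Z'` for `Ψ X` is isomorphic to some `Ψ Z`
    obtain ⟨Z', hZ'⟩ := exists_natCard_hom_eq_finrank (e.functor.obj X)
    have h1 : Nat.card (Z' ⟶ e.functor.obj X) = Nat.card (e.functor.obj (e.inverse.obj Z') ⟶ e.functor.obj X) :=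
      Nat.card_congr (Iso.homCongr (e.counitIso.app Z').symm (Iso.refl _))
    rw [← hZ', h1, natCard_hom_map_eq e.functor]
    exact natCard_hom_le_finrank _ _
  · exact finrank_le_finrank_obj_of_fullyFaithful e.functor X

/-- The same for the inverse functor. [cite: MochizukiFrdI2008, Thm. 6.4 (ii) p.114] -/
theorem finrank_inverse_obj_eq_of_equivalence [Normal F₁ K₁] [Algebra.IsSeparable F₁ K₁] [Normal F₂ K₂]
    [Algebra.IsSeparable F₂ K₂] (e : FinSubextCat F₁ K₁ ≌ FinSubextCat F₂ K₂) (Y : FinSubextCat F₂ K₂) :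
    finrank F₁ (e.inverse.obj Y).L = finrank F₂ Y.L :=
  finrank_obj_eq_of_equivalence e.symm Y

end TwoBases

/-! ### Degrees of morphisms -/

section Morphisms

variable {F : Type u} [Field F] {K : Type u} [Field K] [Algebra F K]

/-- **Tower law along a morphism**: for `f : X → Y` in `D` (an `F`-embedding `L_Y → L_X`),
`[L_X : F] = [L_Y : F] · [L_X : L_Y]`, the last degree taken along `f`. [cite: MochizukiFrdI2008, Ex. 6.3 p.113] -/
theorem finrank_eq_finrank_mul_finrank_along {X Y : FinSubextCat F K} (f : X ⟶ Y) :
    finrank F X.L = finrank F Y.L *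
      @finrank Y.L X.L _ _ f.toAlgHom.toRingHom.toAlgebra.toModule := by
  letI : Algebra Y.L X.L := f.toAlgHom.toRingHom.toAlgebra
  haveI : IsScalarTower F Y.L X.L := IsScalarTower.of_algebraMap_eq fun a => (f.toAlgHom.commutes a).symm
  exact (finrank_mul_finrank F Y.L X.L).symm

/-- The relative degree `[L_X : L_Y]` along `f : X → Y` is positive and DIVIDES `[L_X : F]`, with quotient
`[L_Y : F]`: `[L_X : L_Y] = [L_X : F] / [L_Y : F]`. [cite: MochizukiFrdI2008, Ex. 6.3 p.113] -/
theorem finrank_along_eq_div {X Y : FinSubextCat F K} (f : X ⟶ Y) :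
    @finrank Y.L X.L _ _ f.toAlgHom.toRingHom.toAlgebra.toModule = finrank F X.L / finrank F Y.L := by
  rw [finrank_eq_finrank_mul_finrank_along f, Nat.mul_div_cancel_left _ finrank_pos]

end Morphisms

section MorphismsTwoBases

variable {F₁ : Type u} [Field F₁] {K₁ : Type u} [Field K₁] [Algebra F₁ K₁]
  {F₂ : Type u} [Field F₂] {K₂ : Type u} [Field K₂] [Algebra F₂ K₂]

/-- **The degree of a morphism is invariant under equivalences of base categories**: for `K_i/F_i` normal and
separable, an equivalence `Ψ : D₁ ⥲ D₂` and `f : X → Y` in `D₁`, the relative degree `[L_{Ψ X} : L_{Ψ Y}]` along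
`Ψ f` equals `[L_X : L_Y]` along `f` — the uniformity input of Thm. 6.4 (ii) ("ONE `deg(Ψ^rlf)`": pulling back
along `Spec L_B → Spec L_A` multiplies arithmetic degrees by `[L_B : L_A]` on BOTH sides).
[cite: MochizukiFrdI2008, Thm. 6.4 (ii) p.114] -/
theorem finrank_along_map_eq_of_equivalence [Normal F₁ K₁] [Algebra.IsSeparable F₁ K₁] [Normal F₂ K₂]
    [Algebra.IsSeparable F₂ K₂] (e : FinSubextCat F₁ K₁ ≌ FinSubextCat F₂ K₂) {X Y : FinSubextCat F₁ K₁}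
    (f : X ⟶ Y) :
    @finrank (e.functor.obj Y).L (e.functor.obj X).L _ _ (e.functor.map f).toAlgHom.toRingHom.toAlgebra.toModule =
      @finrank Y.L X.L _ _ f.toAlgHom.toRingHom.toAlgebra.toModule := by
  rw [finrank_along_eq_div, finrank_along_eq_div, finrank_obj_eq_of_equivalence, finrank_obj_eq_of_equivalence]

/-- Cross-multiplied form over the base fields only: `[L_{Ψ X} : F₂] · [L_Y : F₁] = [L_X : F₁] · [L_{Ψ Y} : F₂]`.
[cite: MochizukiFrdI2008, Thm. 6.4 (ii) p.114] -/
theorem finrank_obj_mul_eq_of_equivalence [Normal F₁ K₁] [Algebra.IsSeparable F₁ K₁] [Normal F₂ K₂]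
    [Algebra.IsSeparable F₂ K₂] (e : FinSubextCat F₁ K₁ ≌ FinSubextCat F₂ K₂) (X Y : FinSubextCat F₁ K₁) :
    finrank F₂ (e.functor.obj X).L * finrank F₁ Y.L = finrank F₁ X.L * finrank F₂ (e.functor.obj Y).L := by
  rw [finrank_obj_eq_of_equivalence, finrank_obj_eq_of_equivalence, mul_comm]

end MorphismsTwoBases

end FinSubextCat

end Literature.AlgebraicGeometry.Frobenioids
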